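import Summits.CriticalPhenomena.Ising3DConformalLimit.Theorems.InverseSquareTelemetryPositiveSolutionAsymptoticsAssemblyTools
import HarnessLib

/-!
# Crux `PositiveSolutionAsymptotics` (stmt-CriticalPhenomena-4496), line `registered`:
# tools for the lead's assembly stub, file 2 — one step of the Harnack chain

THEOREM-ONLY helper file (`--supports stmt-CriticalPhenomena-4496`). The Doob transform of `Δ - V`
by the local harmonic comparison function `H` (`latticeLaplacianZd_doob_transform`) makes `u/H`
harmonic for the conductances `H(x)H(y)`; the elliptic Harnack inequality (hypothesis of the shape of
stub T2 `stub_conductanceHarnack`) then propagates near-maximality of `q = u|x|^{α}` from the centre of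
a lattice ball to the next chain point (`propagate`); `scaled_bounds` / `conductance_bounds` give the
uniform ellipticity `4·900^{α}` of the scaled conductances. Everything is [folklore].
-/

noncomputable section

namespace Summit.CriticalPhenomena.Ising3DConformalLimit.Theorems.PositiveSolutionAsymptotics.Assembly

open Literature.Probability.LatticeModels Finset Set Filter Topology

/-! ### One step of the Harnack chain (Doob transform by the local harmonic function `H`) -/

/-- **One Harnack step along the chain.** Let `D ⊆ ℤ³` contain the `ℓ¹`-ball of radius `2Rₙ` about
`z`, let `u > 0` solve `Δu = Vu` on `D`, let `H` solve `ΔH = VH` on `D` with `H = |x|^{-α}` on `∂D`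
and `(1-η)|x|^{-α} ≤ H ≤ (1+η)|x|^{-α}` on `D`, let the scaled conductances `sc·H(x)H(y)` be
`Λ`-elliptic on `D ∪ ∂D`, let `q = u|x|^{α} ≤ Q` on `D ∪ ∂D` and `q(z) ≥ Q - ζ`. If the elliptic
Harnack inequality holds for `Λ`-elliptic conductances with constant `Cst` (hypothesis `hHar`, the
shape of T2), then `q(z') ≥ Q - Cst(3ηQ + ζ)` for every `z'` in the `ℓ¹`-ball of radius `Rₙ` about `z`:
`φ = u/H` is harmonic for the conductances `H(x)H(y)` (`latticeLaplacianZd_doob_transform`),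
`Q/(1-η) - φ ≥ 0` is `≤ 3ηQ + ζ` at `z`, hence `≤ Cst(3ηQ + ζ)` at `z'`. Here `nrm` is any positive
function on `D ∪ ∂D` (the Euclidean norm in the application). [folklore] -/
theorem propagate :
    ∀ (u V H nrm : Literature.Probability.LatticeModels.Site 3 → ℝ) (α η Q ζ Cst Λ sc : ℝ)
    (D : Set (Literature.Probability.LatticeModels.Site 3)) (z z' : Literature.Probability.LatticeModels.Site 3) (Rn : ℕ),
    (∀ (μ : Literature.Probability.LatticeModels.Site 3 → Literature.Probability.LatticeModels.Site 3 → ℝ) (h : Literature.Probability.LatticeModels.Site 3 → ℝ) (x₀ : Literature.Probability.LatticeModels.Site 3) (R : ℕ), 1 ≤ R →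
      (∀ x : Literature.Probability.LatticeModels.Site 3, ∀ i : Fin 3, μ x (x + Pi.single i 1) = μ (x + Pi.single i 1) x) →
      (∀ x : Literature.Probability.LatticeModels.Site 3, ∀ i : Fin 3, Λ⁻¹ ≤ μ x (x + Pi.single i 1) ∧ μ x (x + Pi.single i 1) ≤ Λ) →
      (∀ x : Literature.Probability.LatticeModels.Site 3, 0 ≤ h x) →
      (∀ x : Literature.Probability.LatticeModels.Site 3, (∑ i, |x i - x₀ i|) ≤ 2 * (R : ℤ) →
        (∑ i : Fin 3, (μ x (x + Pi.single i 1) * (h (x + Pi.single i 1) - h x) +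
          μ x (x - Pi.single i 1) * (h (x - Pi.single i 1) - h x))) = 0) →
      ∀ x y : Literature.Probability.LatticeModels.Site 3, (∑ i, |x i - x₀ i|) ≤ (R : ℤ) → (∑ i, |y i - x₀ i|) ≤ (R : ℤ) →
        h x ≤ Cst * h y) →
    1 ≤ Λ → 1 ≤ Cst → 0 ≤ η → η ≤ 1 / 2 → 0 ≤ Q → 0 ≤ ζ → 1 ≤ Rn →
    (∀ x : Literature.Probability.LatticeModels.Site 3, (∑ i, |x i - z i|) ≤ 2 * (Rn : ℤ) → x ∈ D) →
    (∑ i, |z' i - z i|) ≤ (Rn : ℤ) →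
    (∀ x ∈ D ∪ Literature.Probability.LatticeModels.zdOuterBoundary D, 0 < u x) →
    (∀ x ∈ D, Literature.Probability.LatticeModels.latticeLaplacianZd u x = V x * u x) →
    (∀ x ∈ D, Literature.Probability.LatticeModels.latticeLaplacianZd H x = V x * H x) →
    (∀ x ∈ D ∪ Literature.Probability.LatticeModels.zdOuterBoundary D, 0 < nrm x) →
    (∀ y ∈ Literature.Probability.LatticeModels.zdOuterBoundary D, H y = nrm y ^ (-α)) →
    (∀ x ∈ D, (1 - η) * nrm x ^ (-α) ≤ H x ∧ H x ≤ (1 + η) * nrm x ^ (-α)) →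
    (∀ x ∈ D ∪ Literature.Probability.LatticeModels.zdOuterBoundary D, ∀ y ∈ D ∪ Literature.Probability.LatticeModels.zdOuterBoundary D,
      Λ⁻¹ ≤ sc * H x * H y ∧ sc * H x * H y ≤ Λ) →
    (∀ x ∈ D ∪ Literature.Probability.LatticeModels.zdOuterBoundary D, u x * nrm x ^ α ≤ Q) →
    Q - ζ ≤ u z * nrm z ^ α →
    Q - Cst * (3 * η * Q + ζ) ≤ u z' * nrm z' ^ α := by
  intro u V H nrm α η Q ζ Cst Λ sc D z z' Rn hHar hΛ hCst hη0 hη hQ hζ hR hball hz' hupos hueq hHeq hnorm hHoff hHbd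
    hμbd hqQ hz
  classical
  -- abbreviations
  set U : Set (Site 3) := D ∪ zdOuterBoundary D with hU
  have hDU : ∀ x ∈ D, x ∈ U := fun x hx => Or.inl hx
  -- membership of `z`, `z'`
  have hzD : z ∈ D := hball z (by simp)
  have hz'D : z' ∈ D := hball z' (by
    have : (Rn : ℤ) ≤ 2 * (Rn : ℤ) := by omega
    exact hz'.trans this)
  have h1η : 0 < 1 - η := by linarith
  have h1η' : 0 < 1 + η := by linarith
  -- `H > 0` on `U`
  have hHpos : ∀ x ∈ U, 0 < H x := by
    intro x hx
    rcases hx with hx | hx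
    · have h1 := (hHbd x hx).1
      have hp : 0 < (1 - η) * nrm x ^ (-α) := mul_pos h1η (Real.rpow_pos_of_pos (hnorm x (Or.inl hx)) _)
      linarith
    · rw [hHoff x hx]
      exact Real.rpow_pos_of_pos (hnorm x (Or.inr hx)) _
  -- `q` and `φ`
  set q : Site 3 → ℝ := fun x => u x * nrm x ^ α with hq
  set φ : Site 3 → ℝ := fun x => u x / H x with hφ
  have hpow : ∀ x ∈ U, nrm x ^ α * nrm x ^ (-α) = 1 := fun x hx => by
    rw [← Real.rpow_add (hnorm x hx), add_neg_cancel, Real.rpow_zero]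
  have hu_eq : ∀ x ∈ U, u x = q x * nrm x ^ (-α) := fun x hx => by
    simp only [hq]; rw [mul_assoc, hpow x hx, mul_one]
  have hq0 : ∀ x ∈ U, 0 ≤ q x := fun x hx =>
    mul_nonneg (hupos x hx).le (Real.rpow_nonneg (hnorm x hx).le _)
  have hnp : ∀ x ∈ U, 0 < nrm x ^ (-α) := fun x hx => Real.rpow_pos_of_pos (hnorm x hx) _
  -- `q/(1+η) ≤ φ ≤ q/(1-η)` on `D`, `φ = q` on `∂D`
  have hφ_lower : ∀ x ∈ D, q x / (1 + η) ≤ φ x := by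
    intro x hx
    have hxU := hDU x hx
    have hH := (hHbd x hx).2
    have hHp := hHpos x hxU
    simp only [hφ]
    rw [div_le_div_iff₀ h1η' hHp, hu_eq x hxU]
    have := mul_le_mul_of_nonneg_left hH (hq0 x hxU)
    nlinarith [this, hnp x hxU]
  have hφ_upper : ∀ x ∈ D, φ x ≤ q x / (1 - η) := by
    intro x hx
    have hxU := hDU x hx
    have hH := (hHbd x hx).1
    have hHp := hHpos x hxU
    simp only [hφ]
    rw [div_le_div_iff₀ hHp h1η, hu_eq x hxU]
    have := mul_le_mul_of_nonneg_left hH (hq0 x hxU)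
    nlinarith [this, hnp x hxU]
  have hφ_bdry : ∀ x ∈ zdOuterBoundary D, φ x = q x := by
    intro x hx
    have hxU : x ∈ U := Or.inr hx
    simp only [hφ]
    rw [hu_eq x hxU, hHoff x hx, mul_div_assoc, div_self (hnp x hxU).ne', mul_one]
  -- `φ ≤ Q' = Q/(1-η)` on `U`
  set Q' : ℝ := Q / (1 - η) with hQ'
  have hQ'Q : Q ≤ Q' := by
    rw [hQ', le_div_iff₀ h1η]; nlinarith
  have hφQ' : ∀ x ∈ U, φ x ≤ Q' := by
    intro x hx
    by_cases hxD : x ∈ D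
    · exact (hφ_upper x hxD).trans (div_le_div_of_nonneg_right (hqQ x hx) h1η.le)
    · have hxB : x ∈ zdOuterBoundary D := by
        rcases hx with h | h
        · exact absurd h hxD
        · exact h
      rw [hφ_bdry x hxB]
      exact (hqQ x hx).trans hQ'Q
  -- the nonnegative function `h` and the conductances `μ`
  set h : Site 3 → ℝ := fun x => if x ∈ U then Q' - φ x else 0 with hh
  set μ : Site 3 → Site 3 → ℝ := fun x y => if x ∈ U ∧ y ∈ U then sc * H x * H y else 1 with hμ
  have hh0 : ∀ x, 0 ≤ h x := by
    intro x
    simp only [hh]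
    split_ifs with hx
    · linarith [hφQ' x hx]
    · exact le_rfl
  have hμsymm : ∀ x : Site 3, ∀ i : Fin 3,
      μ x (x + Pi.single i 1) = μ (x + Pi.single i 1) x := by
    intro x i
    simp only [hμ]
    split_ifs with h1 h2 h2
    · ring
    · exact absurd h1.symm h2
    · exact absurd h2.symm h1
    · rfl
  have hΛ0 : 0 < Λ := by linarith
  have hμbd' : ∀ x : Site 3, ∀ i : Fin 3,
      Λ⁻¹ ≤ μ x (x + Pi.single i 1) ∧ μ x (x + Pi.single i 1) ≤ Λ := by
    intro x i
    simp only [hμ]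
    by_cases hxy : x ∈ U ∧ x + Pi.single i 1 ∈ U
    · rw [if_pos hxy]; exact hμbd x hxy.1 _ hxy.2
    · rw [if_neg hxy]; exact ⟨inv_le_one_of_one_le₀ hΛ, hΛ⟩
  -- harmonicity of `h` on the `ℓ¹`-ball of radius `2Rₙ`
  have hharm : ∀ x : Site 3, (∑ i, |x i - z i|) ≤ 2 * (Rn : ℤ) →
      (∑ i : Fin 3, (μ x (x + Pi.single i 1) * (h (x + Pi.single i 1) - h x) +
        μ x (x - Pi.single i 1) * (h (x - Pi.single i 1) - h x))) = 0 := by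
    intro x hx
    have hxD : x ∈ D := hball x hx
    have hxU : x ∈ U := Or.inl hxD
    have hpU : ∀ i : Fin 3, x + Pi.single i 1 ∈ U := fun i => add_single_mem_union_zdOuterBoundary hxD i
    have hmU : ∀ i : Fin 3, x - Pi.single i 1 ∈ U := fun i => sub_single_mem_union_zdOuterBoundary hxD i
    have e1 : ∀ i : Fin 3, μ x (x + Pi.single i 1) = sc * H x * H (x + Pi.single i 1) := fun i => by
      simp only [hμ, hxU, hpU i, and_self, if_true]
    have e2 : ∀ i : Fin 3, μ x (x - Pi.single i 1) = sc * H x * H (x - Pi.single i 1) := fun i => by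
      simp only [hμ, hxU, hmU i, and_self, if_true]
    have e3 : h x = Q' - φ x := by simp only [hh, hxU, if_true]
    have e4 : ∀ i : Fin 3, h (x + Pi.single i 1) = Q' - φ (x + Pi.single i 1) := fun i => by
      simp only [hh, hpU i, if_true]
    have e5 : ∀ i : Fin 3, h (x - Pi.single i 1) = Q' - φ (x - Pi.single i 1) := fun i => by
      simp only [hh, hmU i, if_true]
    have doob := latticeLaplacianZd_doob_transform (u := H) (V := V) (x := x) (hHpos x hxU).ne'
      (fun i => (hHpos _ (hpU i)).ne') (fun i => (hHpos _ (hmU i)).ne') (hHeq x hxD) u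
    rw [hueq x hxD, sub_self, mul_zero] at doob
    calc (∑ i : Fin 3, (μ x (x + Pi.single i 1) * (h (x + Pi.single i 1) - h x) +
          μ x (x - Pi.single i 1) * (h (x - Pi.single i 1) - h x)))
        = -sc * ∑ i : Fin 3, (H x * H (x + Pi.single i 1) *
            (u (x + Pi.single i 1) / H (x + Pi.single i 1) - u x / H x) +
          H x * H (x - Pi.single i 1) * (u (x - Pi.single i 1) / H (x - Pi.single i 1) - u x / H x)) := by
          rw [Finset.mul_sum]
          refine Finset.sum_congr rfl fun i _ => ?_
          rw [e1 i, e2 i, e3, e4 i, e5 i]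
          simp only [hφ]
          ring
      _ = 0 := by rw [doob, mul_zero]
  -- the Harnack inequality between `z'` and `z`
  have hzz : (∑ i, |z i - z i|) ≤ (Rn : ℤ) := by simp
  have hHz : h z' ≤ Cst * h z := hHar μ h z Rn hR hμsymm hμbd' hh0 hharm z' z hz' hzz
  have hz_val : h z = Q' - φ z := by simp only [hh, hDU z hzD, if_true]
  have hz'_val : h z' = Q' - φ z' := by simp only [hh, hDU z' hz'D, if_true]
  -- `h z ≤ 3ηQ + ζ`
  have h_z_le : h z ≤ 3 * η * Q + ζ := by
    rw [hz_val]
    have h1 : (Q - ζ) / (1 + η) ≤ φ z :=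
      le_trans (div_le_div_of_nonneg_right hz h1η'.le) (hφ_lower z hzD)
    have h3 := inv_sub_inv_le_three_mul hη0 hη
    have hζ' : ζ / (1 + η) ≤ ζ := div_le_self hζ (by linarith)
    have h4 : Q' - (Q - ζ) / (1 + η) = Q * (1 / (1 - η) - 1 / (1 + η)) + ζ / (1 + η) := by
      rw [hQ']; field_simp; ring
    have h5 : Q * (1 / (1 - η) - 1 / (1 + η)) ≤ Q * (3 * η) := mul_le_mul_of_nonneg_left h3 hQ
    linarith
  -- conclusion
  have hfin : Q' - φ z' ≤ Cst * (3 * η * Q + ζ) := by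
    rw [← hz'_val]
    exact hHz.trans (mul_le_mul_of_nonneg_left h_z_le (by linarith))
  have hφz' : φ z' ≤ q z' / (1 - η) := hφ_upper z' hz'D
  have hK : 0 ≤ Cst * (3 * η * Q + ζ) := by
    have : 0 ≤ Cst := by linarith
    positivity
  have h6 : Q' - Cst * (3 * η * Q + ζ) ≤ q z' / (1 - η) := by linarith
  rw [le_div_iff₀ h1η] at h6
  have hQ'mul : Q' * (1 - η) = Q := div_mul_cancel₀ _ h1η.ne'
  show Q - Cst * (3 * η * Q + ζ) ≤ q z'
  nlinarith

/-! ### Uniform ellipticity of the Doob conductances `H(x)H(y)` -/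

/-- Scaled size of the local harmonic function: if `r/10 ≤ t ≤ 3r` and
`(1-η)t^{-α} ≤ H ≤ (1+η)t^{-α}` (`η ≤ 1/2`, `α ≥ 0`) then `3^{-α}/2 ≤ r^α H ≤ (3/2)10^α`. [folklore] -/
theorem scaled_bounds {r t Hx η α : ℝ} (hr : 0 < r) (hα : 0 ≤ α) (hη : η ≤ 1 / 2)
    (htlo : r / 10 ≤ t) (hthi : t ≤ 3 * r) (hH : (1 - η) * t ^ (-α) ≤ Hx ∧ Hx ≤ (1 + η) * t ^ (-α)) :
    (3 : ℝ) ^ (-α) / 2 ≤ r ^ α * Hx ∧ r ^ α * Hx ≤ 3 / 2 * (10 : ℝ) ^ α := by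
  have ht : 0 < t := by linarith
  have hrt : r ^ α * t ^ (-α) = (r / t) ^ α := by
    rw [Real.rpow_neg ht.le, Real.div_rpow hr.le ht.le, div_eq_mul_inv]
  have hlo : (3 : ℝ) ^ (-α) ≤ (r / t) ^ α := by
    rw [Real.rpow_neg (by norm_num : (0 : ℝ) ≤ 3), ← Real.inv_rpow (by norm_num : (0 : ℝ) ≤ 3)]
    refine Real.rpow_le_rpow (by norm_num) ?_ hα
    rw [le_div_iff₀ ht]; linarith
  have hhi : (r / t) ^ α ≤ (10 : ℝ) ^ α := by
    refine Real.rpow_le_rpow (by positivity) ?_ hα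
    rw [div_le_iff₀ ht]; linarith
  have hrα : 0 ≤ r ^ α := Real.rpow_nonneg hr.le _
  have h1 : r ^ α * ((1 - η) * t ^ (-α)) ≤ r ^ α * Hx := mul_le_mul_of_nonneg_left hH.1 hrα
  have h2 : r ^ α * Hx ≤ r ^ α * ((1 + η) * t ^ (-α)) := mul_le_mul_of_nonneg_left hH.2 hrα
  have e1 : r ^ α * ((1 - η) * t ^ (-α)) = (1 - η) * (r / t) ^ α := by rw [← hrt]; ring
  have e2 : r ^ α * ((1 + η) * t ^ (-α)) = (1 + η) * (r / t) ^ α := by rw [← hrt]; ring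
  rw [e1] at h1
  rw [e2] at h2
  have hq0 : 0 ≤ (r / t) ^ α := Real.rpow_nonneg (by positivity) _
  have h3 : 0 ≤ (3 : ℝ) ^ (-α) := Real.rpow_nonneg (by norm_num) _
  constructor <;> nlinarith

/-- **Uniform ellipticity.** With `Λ = 4·900^α` the scaled conductances `r^α H(x) · r^α H(y)` of two
points as in `scaled_bounds` lie in `[Λ⁻¹, Λ]`. [folklore] -/
theorem conductance_bounds {r tx ty Hx Hy η α : ℝ} (hr : 0 < r) (hα : 0 ≤ α)
    (hη : η ≤ 1 / 2) (hxlo : r / 10 ≤ tx) (hxhi : tx ≤ 3 * r) (hylo : r / 10 ≤ ty) (hyhi : ty ≤ 3 * r)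
    (hHx : (1 - η) * tx ^ (-α) ≤ Hx ∧ Hx ≤ (1 + η) * tx ^ (-α))
    (hHy : (1 - η) * ty ^ (-α) ≤ Hy ∧ Hy ≤ (1 + η) * ty ^ (-α)) :
    (4 * (900 : ℝ) ^ α)⁻¹ ≤ (r ^ α * r ^ α) * Hx * Hy ∧ (r ^ α * r ^ α) * Hx * Hy ≤ 4 * (900 : ℝ) ^ α := by
  obtain ⟨hx1, hx2⟩ := scaled_bounds hr hα hη hxlo hxhi hHx
  obtain ⟨hy1, hy2⟩ := scaled_bounds hr hα hη hylo hyhi hHy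
  have e : (r ^ α * r ^ α) * Hx * Hy = (r ^ α * Hx) * (r ^ α * Hy) := by ring
  rw [e]
  have h3 : 0 < (3 : ℝ) ^ (-α) := Real.rpow_pos_of_pos (by norm_num) _
  have h9 : (3 : ℝ) ^ (-α) * (3 : ℝ) ^ (-α) = ((9 : ℝ) ^ α)⁻¹ := by
    rw [← Real.mul_rpow (by norm_num) (by norm_num), Real.rpow_neg (by norm_num)]; norm_num
  have h100 : (10 : ℝ) ^ α * (10 : ℝ) ^ α = (100 : ℝ) ^ α := by
    rw [← Real.mul_rpow (by norm_num) (by norm_num)]; norm_num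
  have h900 : (900 : ℝ) ^ α = (9 : ℝ) ^ α * (100 : ℝ) ^ α := by
    rw [← Real.mul_rpow (by norm_num) (by norm_num)]; norm_num
  have h9pos : 0 < (9 : ℝ) ^ α := Real.rpow_pos_of_pos (by norm_num) _
  have h100ge : 1 ≤ (100 : ℝ) ^ α := Real.one_le_rpow (by norm_num) hα
  have h9ge : 1 ≤ (9 : ℝ) ^ α := Real.one_le_rpow (by norm_num) hα
  constructor
  · -- lower bound
    have hprod : (3 : ℝ) ^ (-α) / 2 * ((3 : ℝ) ^ (-α) / 2) ≤ (r ^ α * Hx) * (r ^ α * Hy) :=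
      mul_le_mul hx1 hy1 (by positivity) (le_trans (by positivity) hx1)
    refine le_trans ?_ hprod
    have e2 : (3 : ℝ) ^ (-α) / 2 * ((3 : ℝ) ^ (-α) / 2) = ((9 : ℝ) ^ α)⁻¹ / 4 := by
      rw [← h9]; ring
    rw [e2, h900]
    rw [mul_inv, inv_mul_le_iff₀ (by norm_num : (0 : ℝ) < 4)]
    rw [mul_inv]
    have : ((100 : ℝ) ^ α)⁻¹ ≤ 1 := inv_le_one_of_one_le₀ h100ge
    have h9i : 0 < ((9 : ℝ) ^ α)⁻¹ := inv_pos.2 h9pos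
    nlinarith
  · -- upper bound
    have hprod : (r ^ α * Hx) * (r ^ α * Hy) ≤ (3 / 2 * (10 : ℝ) ^ α) * (3 / 2 * (10 : ℝ) ^ α) :=
      mul_le_mul hx2 hy2 (le_trans (by positivity) hy1) (by positivity)
    refine hprod.trans ?_
    have e2 : (3 / 2 * (10 : ℝ) ^ α) * (3 / 2 * (10 : ℝ) ^ α) = 9 / 4 * (100 : ℝ) ^ α := by
      rw [← h100]; ring
    rw [e2, h900]
    have h100pos : 0 < (100 : ℝ) ^ α := by linarith
    nlinarith

end Summit.CriticalPhenomena.Ising3DConformalLimit.Theorems.PositiveSolutionAsymptotics.Assembly
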